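import Summits.BirchSwinnertonDyer.BirchSwinnertonDyer.Theorems.CyclotomicUntwistGammaPushforward
import Summits.BirchSwinnertonDyer.BirchSwinnertonDyer.Theorems.CyclotomicUntwistUntwistedSymbolSystem
import HarnessLib

/-!
# F1 ⟸ GROWTH: the Γ-pushforward of the untwisted Mazur–Tate–Teitelbaum system HAS the D1 property
# `IsUntwistedPAdicLFunction p f η α 𝓛` as soon as it has growth order `½`

Cell `pub/bsd-wall` (D-0145 line `route-BirchSwinnertonDyer-CyclotomicUntwist`), seat `bsd-line-cycu-p1`
(prover seat 1/3, K1 base), helper toward crux K1 `PSRankOneLowerHalfAtThree`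
(stmt-BirchSwinnertonDyer-21580). THEOREMS ONLY (no definition, no named fact, no `sorry`); BSD is not
proved by this file and no crux is.

The route's F1 (wi-84943: `∃ 𝓛, IsPSCyclotomicLFunctionOf W η α 𝓛`, Mazur–Tate–Teitelbaum §I.14 / Kato
Thm 16.2) has three clauses: additivity, growth `½`, interpolation. For the EXPLICIT candidate built in the
rational plus symbols of `f` —
`S_j(y) = ∑_b η(b)[y/p^j + b/p^c]⁺_f`, `ν_M(x) = ∑_{j=1}^{M} α^{-j}p^{j−M}S_j(x) + p^{−M}(1−α/p)⁻¹S_0`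
(`CyclotomicUntwistUntwistedSymbolSystem`), `ρ_M(y) = η̄(y) ν_M(y)`, and the Teichmüller pushforward
`𝓛 n s = ∑_η ∑_{y mod p^{c+e₀+n}, y ≡ ηγ^s (p^{e₀+n})} ρ_{c+e₀+n}(y)` (`CyclotomicUntwistGammaPushforward`) —
this file PROVES the two formal clauses and packages:

* `isGammaDistribution_candidate` — additivity (ν is additive at every level by `fibreSum_nu_eq`, `η̄` is
  constant on fibres from level `c` on, and the pushforward lemma);
* `gammaCharValue_candidate` — THE INTERPOLATION CLAUSE of `IsUntwistedPAdicLFunction`: for `ξ` primitive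
  even of `p`-power order mod `p^m` and `χ` primitive mod `pⁿ` with `χ(a) = η(a)⁻¹ξ(a)` off `p`,
  `∫_Γ ξ d𝓛 = e_n(α) · untwistSymbolSum p f η χ` — `ξ` kills the Teichmüller representatives
  (tree `apply_toZModPow_rootsOfUnity`), the classes exhaust the units (tree `finsum_sum_classes_eq_sum_units`),
  `ξ·η̄ = χ` on units (compat; `n ≤ c + e₀ + m` is forced, `level_le_of_compat`), additivity descends to level
  `pⁿ` (`PSBallSystems.sum_units_mul_of_additive`) where "only the fittest term survives"
  (`PSUntwistedSystem.sum_mulChar_nu_eq`; at `n = 0` the unit mass `mass_units_eq` gives `e_0(α) S_0`);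
* **`isUntwistedPAdicLFunction_of_hasGrowthOrder`**: `HasGrowthOrder p ½ 𝓛 → IsUntwistedPAdicLFunction p f η α 𝓛`,
  for `η` primitive mod `p^c`, `c ≥ 1`, `α ∉ {0, p}`, any cusp form `f` on `Γ₀(N)`.
So F1 for the route is EXACTLY one statement: the growth bound `‖𝓛 n s‖ ≤ C·3^{n/2}` for this explicit system
(the boundedness of the untwist's own modular symbols, Manin–Drinfeld for `g`); nothing is asserted about it here.

References: [cite: MazurTateTeitelbaum1986Invent, §I.10–§I.14 (case p ∣ N)]; [cite: Bellaiche2021, §6.7.2–§6.7.3,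
Thm. 6.7.9]; [cite: Kato2004Asterisque, Thm. 16.2 (p. 154)].
-/

noncomputable section

open scoped MatrixGroups

open CongruenceSubgroup DirichletCharacter Literature.NumberTheory.EllipticCurves
  Literature.NumberTheory.EllipticCurves.ModularForms Literature.NumberTheory.IwasawaTheory
  Summit.BirchSwinnertonDyer.BirchSwinnertonDyer.Theorems.PSUntwisting
  Summit.BirchSwinnertonDyer.BirchSwinnertonDyer.Theorems.PSPrimePowerGauss
  Summit.BirchSwinnertonDyer.BirchSwinnertonDyer.Theorems.PSUntwistedSystem
  Summit.BirchSwinnertonDyer.BirchSwinnertonDyer.Theorems.PSBallSystems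
  Summit.BirchSwinnertonDyer.BirchSwinnertonDyer.Theorems.PSPushforward

-- single-conjunct summit: `Summit.BirchSwinnertonDyer.BirchSwinnertonDyer.…` repeats the name by design
set_option linter.dupNamespace false
set_option autoImplicit false

namespace Summit.BirchSwinnertonDyer.BirchSwinnertonDyer.Theorems.PSF1Reduction

variable {p : ℕ} [Fact p.Prime]

/-! ### §1 Characters: the level bound forced by the compatibility clause, and `ξ` on the classes -/

section Characters

variable {c m n : ℕ} (η : DirichletCharacter ℂ_[p] (p ^ c)) (ξ : DirichletCharacter ℂ_[p] (p ^ m))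
  (χ : DirichletCharacter ℂ_[p] (p ^ n))

/-- **The compatibility clause bounds the level of `χ`**: if `χ` is primitive mod `pⁿ` and
`χ(a) = η(a)⁻¹ ξ(a)` for all `a` prime to `p`, then `n ≤ B` for every `B ≥ c, m` (else `χ` is trivial on the
units `≡ 1 (mod p^B)` and factors through `p^B`). [folklore] -/
theorem level_le_of_compat (hχ : χ.IsPrimitive)
    (hcompat : ∀ a : ℕ, a.Coprime p → χ (a : ZMod (p ^ n)) = (η (a : ZMod (p ^ c)))⁻¹ * ξ (a : ZMod (p ^ m)))
    {B : ℕ} (hcB : c ≤ B) (hmB : m ≤ B) : n ≤ B := by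
  haveI : NeZero (p ^ n) := ⟨pow_ne_zero _ (Fact.out : p.Prime).ne_zero⟩
  have hp : p.Prime := Fact.out
  by_contra hlt
  push Not at hlt
  have hn : 0 < n := by omega
  have hfac : χ.FactorsThrough (p ^ B) := by
    rw [factorsThrough_iff_ker_unitsMap (pow_dvd_pow p hlt.le)]
    intro u hu
    rw [MonoidHom.mem_ker] at hu ⊢
    apply Units.ext
    rw [MulChar.coe_toUnitHom, Units.val_one]
    obtain ⟨q, hq⟩ := exists_eq_one_add_of_unitsMap_eq_one hlt.le hu
    have hcop : (u : ZMod (p ^ n)).val.Coprime p := (isUnit_iff_coprime_val hn _).mp u.isUnit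
    -- `u.val ≡ 1 (mod p^B)`, hence `≡ 1` modulo `p^c` and `p^m`
    have hval : ((u : ZMod (p ^ n)).val : ZMod (p ^ B)) = 1 := by
      have h := congrArg (ZMod.castHom (pow_dvd_pow p hlt.le) (ZMod (p ^ B))) hq
      rw [map_add, map_one, map_mul, map_natCast, map_natCast, ZMod.natCast_self, zero_mul, add_zero,
        ZMod.castHom_apply, ZMod.cast_eq_val] at h
      exact h
    have hc1 : ((u : ZMod (p ^ n)).val : ZMod (p ^ c)) = 1 := by
      have h := congrArg (ZMod.castHom (pow_dvd_pow p hcB) (ZMod (p ^ c))) hval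
      rwa [map_natCast, map_one] at h
    have hm1 : ((u : ZMod (p ^ n)).val : ZMod (p ^ m)) = 1 := by
      have h := congrArg (ZMod.castHom (pow_dvd_pow p hmB) (ZMod (p ^ m))) hval
      rwa [map_natCast, map_one] at h
    rw [← ZMod.natCast_zmod_val (u : ZMod (p ^ n)), hcompat _ hcop, hc1, hm1, map_one, map_one, inv_one,
      one_mul]
  have hle : χ.conductor ≤ p ^ B := Nat.sInf_le ((mem_conductorSet_iff χ).mpr hfac)
  have hprim : χ.conductor = p ^ n := hχ
  have hltp : p ^ B < p ^ n := Nat.pow_lt_pow_right hp.one_lt hlt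
  omega

/-- On a unit `y` of level `L ≥ n, m, c`: `ξ(y) · η⁻¹(y) = χ(y)` (all read through the canonical
representative `ỹ`), by the compatibility clause. [folklore] -/
theorem xi_mul_etaInv_eq_chi
    (hcompat : ∀ a : ℕ, a.Coprime p → χ (a : ZMod (p ^ n)) = (η (a : ZMod (p ^ c)))⁻¹ * ξ (a : ZMod (p ^ m)))
    {L : ℕ} (hL : 0 < L) (u : (ZMod (p ^ L))ˣ) :
    ξ (((u : ZMod (p ^ L)).val : ℕ) : ZMod (p ^ m)) * η⁻¹ (((u : ZMod (p ^ L)).val : ℕ) : ZMod (p ^ c)) =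
      χ (((u : ZMod (p ^ L)).val : ℕ) : ZMod (p ^ n)) := by
  have hcop : (u : ZMod (p ^ L)).val.Coprime p := (isUnit_iff_coprime_val hL _).mp u.isUnit
  rw [hcompat _ hcop, MulChar.inv_apply_eq_inv', mul_comm]

end Characters

/-! ### §2 The candidate system: additivity of `ν` (filtered form) and of `ρ = η̄·ν` from level `c` on -/

section Candidate

variable {N : ℕ} [NeZero N] (f : CuspForm (Gamma0 N) 2)
variable {c : ℕ} (η : DirichletCharacter ℂ_[p] (p ^ c)) (α : ℂ_[p])
variable (S : (j : ℕ) → ZMod (p ^ j) → ℂ_[p])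
variable (hS : ∀ (j : ℕ) (y : ZMod (p ^ j)), S j y = ∑ b : ZMod (p ^ c), η b *
  algebraMap ℚ ℂ_[p] (ratPlusSymbol f ((y.val : ℚ) / (p : ℚ) ^ j + (b.val : ℚ) / (p : ℚ) ^ c)))
variable (ν : (M : ℕ) → ZMod (p ^ M) → ℂ_[p])
variable (hν : ∀ (M : ℕ) (x : ZMod (p ^ M)), ν M x =
  (∑ i ∈ Finset.range M, α⁻¹ ^ (i + 1) * ((p : ℂ_[p]) ^ (i + 1) / (p : ℂ_[p]) ^ M) *
      S (i + 1) ((x.val : ℕ) : ZMod (p ^ (i + 1)))) +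
    ((p : ℂ_[p]) ^ M)⁻¹ * (1 - α / p)⁻¹ * S 0 0)
variable (ρ : (M : ℕ) → ZMod (p ^ M) → ℂ_[p])
variable (hρ : ∀ (M : ℕ) (y : ZMod (p ^ M)), ρ M y = η⁻¹ ((y.val : ℕ) : ZMod (p ^ c)) * ν M y)
variable (𝓛 : (n : ℕ) → ZMod (p ^ n) → ℂ_[p])
variable (h𝓛 : ∀ (n : ℕ) (s : ZMod (p ^ n)), 𝓛 n s =
  ∑ᶠ T : rootsOfUnity (torsionOrder p) ℤ_[p],
    ∑ y ∈ Finset.univ.filter (fun y : ZMod (p ^ (c + cyclotomicExponent p + n)) ↦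
      ZMod.castHom (pow_dvd_pow p (by omega : cyclotomicExponent p + n ≤ c + cyclotomicExponent p + n))
          (ZMod (p ^ (cyclotomicExponent p + n))) y =
        PadicInt.toZModPow (cyclotomicExponent p + n) ((T : ℤ_[p]ˣ) : ℤ_[p]) *
          (cyclotomicGenerator p : ZMod (p ^ (cyclotomicExponent p + n))) ^ s.val),
      ρ (c + cyclotomicExponent p + n) y)

include hS hν in
/-- **`ν` is additive in the filtered sense** at every level (bridge from `PSUntwistedSystem.fibreSum_nu_eq`).
[cite: MazurTateTeitelbaum1986Invent, §I.10–§I.11] -/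
theorem nu_additive (hc : 0 < c) (hη : η.IsPrimitive) (M : ℕ) (a : ZMod (p ^ M)) :
    ∑ b ∈ Finset.univ.filter (fun b : ZMod (p ^ (M + 1)) ↦
      ZMod.castHom (pow_dvd_pow p M.le_succ) (ZMod (p ^ M)) b = a), ν (M + 1) b = ν M a := by
  rw [sum_filter_castHom_eq_sum_param]
  exact fibreSum_nu_eq f η α S hS ν hν hc hη M a

include hS hν hρ in
/-- **`ρ = η̄·ν` is additive from level `c` on** (`η̄` is constant on the fibres of `ℤ/p^{M+1} → ℤ/p^M` for
`M ≥ c`). [cite: MazurTateTeitelbaum1986Invent, §I.11] -/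
theorem rho_additive (hc : 0 < c) (hη : η.IsPrimitive) (M : ℕ) (hM : c ≤ M) (a : ZMod (p ^ M)) :
    ∑ b ∈ Finset.univ.filter (fun b : ZMod (p ^ (M + 1)) ↦
      ZMod.castHom (pow_dvd_pow p M.le_succ) (ZMod (p ^ M)) b = a), ρ (M + 1) b = ρ M a := by
  classical
  haveI : NeZero (p ^ M) := ⟨pow_ne_zero _ (Fact.out : p.Prime).ne_zero⟩
  haveI : NeZero (p ^ (M + 1)) := ⟨pow_ne_zero _ (Fact.out : p.Prime).ne_zero⟩
  have hconst : ∀ b ∈ Finset.univ.filter (fun b : ZMod (p ^ (M + 1)) ↦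
      ZMod.castHom (pow_dvd_pow p M.le_succ) (ZMod (p ^ M)) b = a),
      η⁻¹ ((b.val : ℕ) : ZMod (p ^ c)) = η⁻¹ ((a.val : ℕ) : ZMod (p ^ c)) := by
    intro b hb
    have hba := (Finset.mem_filter.mp hb).2
    rw [ZMod.castHom_apply, ZMod.cast_eq_val] at hba
    -- `(b.val : ℤ/p^c) = (a.val : ℤ/p^c)` via `ℤ/p^M`
    have h : ((b.val : ℕ) : ZMod (p ^ c)) = ((a.val : ℕ) : ZMod (p ^ c)) := by
      have h1 := congrArg (ZMod.castHom (pow_dvd_pow p hM) (ZMod (p ^ c))) hba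
      rw [map_natCast, ZMod.castHom_apply, ZMod.cast_eq_val] at h1
      exact h1
    rw [h]
  rw [hρ M a]
  calc ∑ b ∈ Finset.univ.filter (fun b : ZMod (p ^ (M + 1)) ↦
        ZMod.castHom (pow_dvd_pow p M.le_succ) (ZMod (p ^ M)) b = a), ρ (M + 1) b
      = ∑ b ∈ Finset.univ.filter (fun b : ZMod (p ^ (M + 1)) ↦
        ZMod.castHom (pow_dvd_pow p M.le_succ) (ZMod (p ^ M)) b = a),
          η⁻¹ ((a.val : ℕ) : ZMod (p ^ c)) * ν (M + 1) b := by
        refine Finset.sum_congr rfl fun b hb ↦ ?_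
        rw [hρ, hconst b hb]
    _ = η⁻¹ ((a.val : ℕ) : ZMod (p ^ c)) * ν M a := by
        rw [← Finset.mul_sum, nu_additive f η α S hS ν hν hc hη M a]

include hS hν hρ h𝓛 in
/-- **Additivity of the candidate**: `IsGammaDistribution p 𝓛`. [cite: MazurTateTeitelbaum1986Invent, §I.11 and §I.13] -/
theorem isGammaDistribution_candidate (hc : 0 < c) (hη : η.IsPrimitive) : IsGammaDistribution p 𝓛 :=
  isGammaDistribution_pushforward ρ (fun M hM a ↦ rho_additive f η α S hS ν hν ρ hρ hc hη M hM a) 𝓛 h𝓛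

end Candidate

/-! ### §3 The interpolation clause -/

/-- Regrouping a sum over the units of level `L` by their residues at a level `E ≤ L` (`1 ≤ E`): units lie
exactly over units. [folklore] -/
theorem sum_units_eq_sum_units_fibre {E L : ℕ} (hE : 1 ≤ E) (hEL : E ≤ L) (G : ZMod (p ^ L) → ℂ_[p]) :
    ∑ u : (ZMod (p ^ L))ˣ, G u =
      ∑ v : (ZMod (p ^ E))ˣ, ∑ y ∈ Finset.univ.filter (fun y : ZMod (p ^ L) ↦
        ZMod.castHom (pow_dvd_pow p hEL) (ZMod (p ^ E)) y = v), G y := by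
  classical
  haveI : NeZero (p ^ L) := ⟨pow_ne_zero _ (Fact.out : p.Prime).ne_zero⟩
  haveI : NeZero (p ^ E) := ⟨pow_ne_zero _ (Fact.out : p.Prime).ne_zero⟩
  set π := ZMod.castHom (pow_dvd_pow p hEL) (ZMod (p ^ E)) with hπ
  rw [sum_units_eq_sum_filter_isUnit (F := G),
    sum_units_eq_sum_filter_isUnit (F := fun v : ZMod (p ^ E) ↦
      ∑ y ∈ Finset.univ.filter (fun y : ZMod (p ^ L) ↦ π y = v), G y),
    ← Finset.sum_fiberwise_of_maps_to (s := Finset.univ.filter (fun y : ZMod (p ^ L) ↦ IsUnit y))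
      (t := Finset.univ.filter (fun v : ZMod (p ^ E) ↦ IsUnit v)) (g := π) ?_]
  · refine Finset.sum_congr rfl fun v hv ↦ Finset.sum_congr ?_ fun _ _ ↦ rfl
    have hvu := (Finset.mem_filter.mp hv).2
    ext y
    simp only [Finset.mem_filter, Finset.mem_univ, true_and, and_iff_right_iff_imp]
    intro hy
    rw [isUnit_iff_isUnit_castHom (p := p) hE hEL, hy]
    exact hvu
  · intro y hy
    simp only [Finset.mem_filter, Finset.mem_univ, true_and] at hy ⊢
    exact (isUnit_iff_isUnit_castHom (p := p) hE hEL y).mp hy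

/-- **Classes × fibres = units**: summing `G` over the points above each class `η γ^s (mod p^{e₀+m})`, over all
Teichmüller `η` and all `s mod p^m`, is summing `G` over the units of level `L ≥ e₀ + m` (tree
`finsum_sum_classes_eq_sum_units`, transported to levels `e₀ + m`). [cite: MazurTateTeitelbaum1986Invent, §I.13] -/
theorem finsum_sum_sum_fibre_eq_sum_units {m L : ℕ} (hEL : cyclotomicExponent p + m ≤ L)
    (G : ZMod (p ^ L) → ℂ_[p]) :
    ∑ᶠ T : rootsOfUnity (torsionOrder p) ℤ_[p], ∑ s : ZMod (p ^ m),
      ∑ y ∈ Finset.univ.filter (fun y : ZMod (p ^ L) ↦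
        ZMod.castHom (pow_dvd_pow p hEL) (ZMod (p ^ (cyclotomicExponent p + m))) y =
          PadicInt.toZModPow (cyclotomicExponent p + m) ((T : ℤ_[p]ˣ) : ℤ_[p]) *
            (cyclotomicGenerator p : ZMod (p ^ (cyclotomicExponent p + m))) ^ s.val), G y =
      ∑ u : (ZMod (p ^ L))ˣ, G u := by
  classical
  have h := @finsum_sum_classes_eq_sum_units p _ m ℂ_[p] _
  rw [Nat.add_comm m (cyclotomicExponent p)] at h
  rw [h (fun v ↦ ∑ y ∈ Finset.univ.filter (fun y : ZMod (p ^ L) ↦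
      ZMod.castHom (pow_dvd_pow p hEL) (ZMod (p ^ (cyclotomicExponent p + m))) y = v), G y)]
  exact (sum_units_eq_sum_units_fibre
    (le_add_right (Nat.pos_of_ne_zero (cyclotomicExponent_ne_zero p))) hEL G).symm

section Interpolation

variable {N : ℕ} [NeZero N] (f : CuspForm (Gamma0 N) 2)
variable {c : ℕ} (η : DirichletCharacter ℂ_[p] (p ^ c)) (α : ℂ_[p])
variable (S : (j : ℕ) → ZMod (p ^ j) → ℂ_[p])
variable (hS : ∀ (j : ℕ) (y : ZMod (p ^ j)), S j y = ∑ b : ZMod (p ^ c), η b *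
  algebraMap ℚ ℂ_[p] (ratPlusSymbol f ((y.val : ℚ) / (p : ℚ) ^ j + (b.val : ℚ) / (p : ℚ) ^ c)))
variable (ν : (M : ℕ) → ZMod (p ^ M) → ℂ_[p])
variable (hν : ∀ (M : ℕ) (x : ZMod (p ^ M)), ν M x =
  (∑ i ∈ Finset.range M, α⁻¹ ^ (i + 1) * ((p : ℂ_[p]) ^ (i + 1) / (p : ℂ_[p]) ^ M) *
      S (i + 1) ((x.val : ℕ) : ZMod (p ^ (i + 1)))) +
    ((p : ℂ_[p]) ^ M)⁻¹ * (1 - α / p)⁻¹ * S 0 0)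
variable (ρ : (M : ℕ) → ZMod (p ^ M) → ℂ_[p])
variable (hρ : ∀ (M : ℕ) (y : ZMod (p ^ M)), ρ M y = η⁻¹ ((y.val : ℕ) : ZMod (p ^ c)) * ν M y)
variable (𝓛 : (n : ℕ) → ZMod (p ^ n) → ℂ_[p])
variable (h𝓛 : ∀ (n : ℕ) (s : ZMod (p ^ n)), 𝓛 n s =
  ∑ᶠ T : rootsOfUnity (torsionOrder p) ℤ_[p],
    ∑ y ∈ Finset.univ.filter (fun y : ZMod (p ^ (c + cyclotomicExponent p + n)) ↦
      ZMod.castHom (pow_dvd_pow p (by omega : cyclotomicExponent p + n ≤ c + cyclotomicExponent p + n))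
          (ZMod (p ^ (cyclotomicExponent p + n))) y =
        PadicInt.toZModPow (cyclotomicExponent p + n) ((T : ℤ_[p]ˣ) : ℤ_[p]) *
          (cyclotomicGenerator p : ZMod (p ^ (cyclotomicExponent p + n))) ^ s.val),
      ρ (c + cyclotomicExponent p + n) y)

include hρ h𝓛 in
/-- **Step 1 of the interpolation**: `∫_Γ ξ d𝓛 = ∑_{u ∈ (ℤ/p^L)ˣ} ξ(ũ) η̄(ũ) ν_L(u)`, `L = c + e₀ + m`, for `ξ`
even of `p`-power order mod `p^m` (`ξ` kills the Teichmüller part: `ξ(y) = ξ(γ^s)` on the class of `η γ^s`).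
[cite: MazurTateTeitelbaum1986Invent, §I.13] -/
theorem gammaCharValue_eq_sum_units {m : ℕ} (ξ : DirichletCharacter ℂ_[p] (p ^ m)) (hξe : ξ.Even)
    (hξo : ∃ j : ℕ, orderOf ξ = p ^ j) :
    gammaCharValue p 𝓛 ξ = ∑ u : (ZMod (p ^ (c + cyclotomicExponent p + m)))ˣ,
      ξ (((u : ZMod (p ^ (c + cyclotomicExponent p + m))).val : ℕ) : ZMod (p ^ m)) *
        (η⁻¹ (((u : ZMod (p ^ (c + cyclotomicExponent p + m))).val : ℕ) : ZMod (p ^ c)) *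
          ν (c + cyclotomicExponent p + m) u) := by
  classical
  haveI : NeZero (p ^ m) := ⟨pow_ne_zero _ (Fact.out : p.Prime).ne_zero⟩
  haveI := neZero_torsionOrder p
  haveI := Fintype.ofFinite (rootsOfUnity (torsionOrder p) ℤ_[p])
  have hEL : cyclotomicExponent p + m ≤ c + cyclotomicExponent p + m := by omega
  have hmE : m ≤ cyclotomicExponent p + m := by omega
  -- `ξ(γ^s) = ξ(ỹ)` on the class of `η γ^s`
  have hin : ∀ s : ZMod (p ^ m), ∀ T : rootsOfUnity (torsionOrder p) ℤ_[p],
      ∀ y ∈ Finset.univ.filter (fun y : ZMod (p ^ (c + cyclotomicExponent p + m)) ↦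
        ZMod.castHom (pow_dvd_pow p hEL) (ZMod (p ^ (cyclotomicExponent p + m))) y =
          PadicInt.toZModPow (cyclotomicExponent p + m) ((T : ℤ_[p]ˣ) : ℤ_[p]) *
            (cyclotomicGenerator p : ZMod (p ^ (cyclotomicExponent p + m))) ^ s.val),
      ξ ((cyclotomicGenerator p : ZMod (p ^ m)) ^ s.val) =
        ξ ((y.val : ℕ) : ZMod (p ^ m)) := by
    intro s T y hy
    have hcls := (Finset.mem_filter.mp hy).2
    have h2 := congrArg (ZMod.castHom (pow_dvd_pow p hmE) (ZMod (p ^ m))) hcls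
    rw [castHom_castHom_zmod, map_mul, map_pow, map_natCast, ZMod.castHom_apply, ZMod.castHom_apply,
      ZMod.cast_eq_val, PadicInt.cast_toZModPow _ _ hmE] at h2
    rw [h2, map_mul, map_pow, apply_toZModPow_rootsOfUnity ξ hξe hξo T, one_mul]
  have hterm : ∀ s : ZMod (p ^ m), ξ ((cyclotomicGenerator p : ZMod (p ^ m)) ^ s.val) * 𝓛 m s =
      ∑ T : rootsOfUnity (torsionOrder p) ℤ_[p],
        ∑ y ∈ Finset.univ.filter (fun y : ZMod (p ^ (c + cyclotomicExponent p + m)) ↦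
          ZMod.castHom (pow_dvd_pow p hEL) (ZMod (p ^ (cyclotomicExponent p + m))) y =
            PadicInt.toZModPow (cyclotomicExponent p + m) ((T : ℤ_[p]ˣ) : ℤ_[p]) *
              (cyclotomicGenerator p : ZMod (p ^ (cyclotomicExponent p + m))) ^ s.val),
          ξ ((y.val : ℕ) : ZMod (p ^ m)) * ρ (c + cyclotomicExponent p + m) y := by
    intro s
    rw [h𝓛 m s, finsum_eq_sum_of_fintype, Finset.mul_sum]
    refine Finset.sum_congr rfl fun T _ ↦ ?_
    rw [Finset.mul_sum]
    refine Finset.sum_congr rfl fun y hy ↦ ?_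
    rw [hin s T y hy]
  rw [gammaCharValue_def, Finset.sum_congr rfl (fun s _ ↦ hterm s), Finset.sum_comm]
  have hcls := finsum_sum_sum_fibre_eq_sum_units (p := p) hEL
    (fun y : ZMod (p ^ (c + cyclotomicExponent p + m)) ↦
      ξ ((y.val : ℕ) : ZMod (p ^ m)) * ρ (c + cyclotomicExponent p + m) y)
  rw [finsum_eq_sum_of_fintype] at hcls
  rw [hcls]
  refine Finset.sum_congr rfl fun u _ ↦ ?_
  rw [hρ]

include hS hν hρ h𝓛 in
/-- **THE INTERPOLATION CLAUSE of `IsUntwistedPAdicLFunction` for the candidate.** For `η` primitive mod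
`p^c` (`c ≥ 1`), `α ∉ {0, p}`, `ξ` primitive even of `p`-power order mod `p^m`, and `χ` primitive mod `pⁿ` with
`χ(a) = η(a)⁻¹ξ(a)` off `p`: `∫_Γ ξ d𝓛 = e_n(α) · untwistSymbolSum p f η χ`.
[cite: MazurTateTeitelbaum1986Invent, §I.13–§I.14 (case p ∣ N)] [cite: Bellaiche2021, Thm. 6.7.9] -/
theorem gammaCharValue_candidate (hc : 0 < c) (hη : η.IsPrimitive) (hα : α ≠ 0) (hαp : α ≠ p)
    (m : ℕ) (ξ : DirichletCharacter ℂ_[p] (p ^ m)) (hξe : ξ.Even)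
    (hξo : ∃ j : ℕ, orderOf ξ = p ^ j) (n : ℕ) (χ : DirichletCharacter ℂ_[p] (p ^ n)) (hχ : χ.IsPrimitive)
    (hcompat : ∀ a : ℕ, a.Coprime p → χ (a : ZMod (p ^ n)) = (η (a : ZMod (p ^ c)))⁻¹ * ξ (a : ZMod (p ^ m))) :
    gammaCharValue p 𝓛 ξ = untwistMultiplier p α n * untwistSymbolSum p f η χ := by
  classical
  have hp : p.Prime := Fact.out
  have hL0 : 0 < c + cyclotomicExponent p + m := by omega
  have hnL : n ≤ c + cyclotomicExponent p + m := level_le_of_compat η ξ χ hχ hcompat (by omega) (by omega)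
  have hadd := nu_additive f η α S hS ν hν hc hη
  rw [gammaCharValue_eq_sum_units η ν ρ hρ 𝓛 h𝓛 ξ hξe hξo]
  -- `ξ(ũ) η̄(ũ) = χ(ũ)` on units
  have hχu : ∀ u : (ZMod (p ^ (c + cyclotomicExponent p + m)))ˣ,
      ξ (((u : ZMod (p ^ (c + cyclotomicExponent p + m))).val : ℕ) : ZMod (p ^ m)) *
        (η⁻¹ (((u : ZMod (p ^ (c + cyclotomicExponent p + m))).val : ℕ) : ZMod (p ^ c)) *
          ν (c + cyclotomicExponent p + m) u) =
      ν (c + cyclotomicExponent p + m) u * χ (ZMod.castHom (pow_dvd_pow p hnL) (ZMod (p ^ n)) u) := by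
    intro u
    rw [← mul_assoc, xi_mul_etaInv_eq_chi η ξ χ hcompat hL0 u, ZMod.castHom_apply, ZMod.cast_eq_val,
      mul_comm]
  simp_rw [hχu]
  rcases Nat.eq_zero_or_pos n with hn0 | hn
  · -- `n = 0`: `χ` is trivial, the sum is the mass of the units
    subst hn0
    have hχ1 : ∀ x : ZMod (p ^ 0), χ x = 1 := fun x ↦ by
      rw [zmod_pow_zero_eq_zero x, ← zmod_pow_zero_eq_zero (1 : ZMod (p ^ 0)), map_one]
    simp_rw [hχ1, mul_one]
    -- down to level `1`
    have h1 : ∑ u : (ZMod (p ^ (c + cyclotomicExponent p + m)))ˣ, ν (c + cyclotomicExponent p + m) u =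
        ∑ a : (ZMod (p ^ 1))ˣ, ν 1 a := by
      have h := sum_units_mul_of_additive ν hadd (le_refl 1) (by omega : 1 ≤ c + cyclotomicExponent p + m)
        (fun _ ↦ (1 : ℂ_[p]))
      simpa using h
    rw [h1]
    -- units of `ℤ/p` are the non-zero classes
    haveI : NeZero (p ^ 1) := ⟨pow_ne_zero _ hp.ne_zero⟩
    have h2 : ∑ a : (ZMod (p ^ 1))ˣ, ν 1 a = ∑ x : ZMod (p ^ 1), ν 1 x - ν 1 0 := by
      rw [sum_units_eq_sum_filter_isUnit (F := ν 1)]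
      have hfil : Finset.univ.filter (fun a : ZMod (p ^ 1) ↦ IsUnit a) = Finset.univ.erase 0 := by
        ext a
        simp [isUnit_iff_ne_zero_level_one]
      rw [hfil, Finset.sum_erase_eq_sub (Finset.mem_univ _)]
    rw [h2, mass_units_eq f η α S hS ν hν hc hη hα hαp, untwistMultiplier_zero]
    -- `untwistSymbolSum` at level `0` is `S 0 0`
    congr 1
    rw [hS]
    unfold untwistSymbolSum
    rw [sum_zmod_pow_zero]
    refine Finset.sum_congr rfl fun b _ ↦ ?_
    rw [hχ1, one_mul]
  · -- `n ≥ 1`: down to level `n`, then "only the fittest term survives"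
    have h1 : ∑ u : (ZMod (p ^ (c + cyclotomicExponent p + m)))ˣ,
        ν (c + cyclotomicExponent p + m) u * χ (ZMod.castHom (pow_dvd_pow p hnL) (ZMod (p ^ n)) u) =
        ∑ a : (ZMod (p ^ n))ˣ, ν n a * χ a :=
      sum_units_mul_of_additive ν hadd hn hnL (fun a ↦ χ a)
    rw [h1]
    haveI : NeZero (p ^ n) := ⟨pow_ne_zero _ hp.ne_zero⟩
    have h2 : ∑ a : (ZMod (p ^ n))ˣ, ν n a * χ a = ∑ x : ZMod (p ^ n), χ x * ν n x := by
      rw [sum_units_eq_sum_filter_isUnit (F := fun a : ZMod (p ^ n) ↦ ν n a * χ a), Finset.sum_filter]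
      refine Finset.sum_congr rfl fun a _ ↦ ?_
      split_ifs with ha
      · exact mul_comm _ _
      · rw [MulChar.map_nonunit χ ha, zero_mul]
    rw [h2, sum_mulChar_nu_eq f η α S ν hν hS hn χ hχ, untwistMultiplier_of_ne_zero α hn.ne']

include hS hν hρ h𝓛 in
/-- **F1 ⟸ GROWTH.** For `η` primitive mod `p^c` (`c ≥ 1`), `α ∉ {0, p}`, any cusp form `f` on `Γ₀(N)`, and
the explicit candidate `𝓛` (untwisted MTT system of `f`-symbols pushed forward to `Γ`): if `𝓛` has growth
order `½` then `𝓛` HAS the D1 property (primitivity of `ξ` is not even needed for the interpolation clause) `IsUntwistedPAdicLFunction p f η α 𝓛` — additivity and interpolation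
being theorems. The route's F1 is thus exactly the growth bound for this explicit system (= boundedness of the
untwist's own modular symbols, Manin–Drinfeld for `g`). [cite: MazurTateTeitelbaum1986Invent, §I.14 (case p ∣ N)]
[cite: Kato2004Asterisque, Thm. 16.2] -/
theorem isUntwistedPAdicLFunction_of_hasGrowthOrder (hc : 0 < c) (hη : η.IsPrimitive) (hα : α ≠ 0)
    (hαp : α ≠ p) (hgrowth : HasGrowthOrder p (1 / 2) 𝓛) : IsUntwistedPAdicLFunction p f η α 𝓛 :=
  ⟨isGammaDistribution_candidate f η α S hS ν hν ρ hρ 𝓛 h𝓛 hc hη, hgrowth,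
    fun m ξ _ hξe hξo n χ hχ hcompat ↦
      gammaCharValue_candidate f η α S hS ν hν ρ hρ 𝓛 h𝓛 hc hη hα hαp m ξ hξe hξo n χ hχ hcompat⟩

end Interpolation

end Summit.BirchSwinnertonDyer.BirchSwinnertonDyer.Theorems.PSF1Reduction
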